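/-
Copyright (c) 2026. All rights reserved.
Released under Apache 2.0 license as described in the file LICENSE.
-/
import Literature.NumberTheory.GaloisRepresentations.TateDualityTwoZeroSurj
import Literature.NumberTheory.GaloisRepresentations.LocalDualityTheorem
import Literature.NumberTheory.GaloisRepresentations.Corestriction
import HarnessLib

/-!
# Local duality in bidegrees `(0, 2)` / `(2, 0)`: the inputs over `Gal(F̄/E)`

For the dévissages `zeroTwo_left_eq_zero_of_devissage` and `twoZero_surjective_of_devissage`
(Serre, *Cohomologie galoisienne*, II §5.2 Thm. 2, cases `i = 0, 2`) run over the absolute Galois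
group `Gal(F̄/E)` of a finite extension `E` of a non-archimedean local field `F` of characteristic
`0` inside which **`μ_p` is fixed** (the extension cut out by a Sylow `p`-subgroup of the image of
`Γ_F` on `M × μ_n`), this file provides the hypotheses on lines `W` of order `p` with trivial
action (`Ω = μ_n`, `p ∣ n`, `ι : H²(E, μ_n) ↪ ℤ/n`):

* `lineIsoMu` — `W ≅ μ_p` as `Gal(F̄/E)`-modules; finiteness of `H¹(E, W)`, `H¹(E, W^D)`,
  `H²(E, W)` (`finite_one_line`, `finite_one_lineDual`, `finite_two_line`), through Shapiro
  (`finite_continuousCohomology_one_restrict`: `H¹(S, X) = sh(H¹(Γ_F, M_Γ^S X))` is finite for a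
  finite `Γ_F`-module `X` and `S` closed of finite index) and `|H²(E, μ_p)| = p`;
* `zeroTwo_left_line` — the left kernel of `W × H²(E, W^D) → ℤ/n` is trivial (the right kernel is,
  `zeroTwo_eq_zero_galFixing`, and `|H²(E, W^D)| = |H²(E, μ_p)| = p ≠ 1`);
* `twoZero_surjective_line` — every additive `H²(E, W) → ℤ/n` is `⟨·, h⟩` for an invariant
  `h ∈ W^D` (`H²(E, W) ≅ H²(E, μ_p) ↪ H²(E, μ_n) ↪ ℤ/n` is cyclic, and `Hom(C, ℤ/n)` is generated
  by any injection for `C` cyclic);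
* `dualityPairing_right_line` — the right kernel of `H¹(E, W) × H¹(E, W^D) → ℤ/n` is trivial
  (`dualityPairing_bijective_of_injective` with `dualityPairing_injective_line` for `W` and `W^D`).

## References
* J.-P. Serre, *Galois Cohomology*, Springer, 1997, II §5.2 Thm. 2 (proof). [SerreGaloisCohomology1997]
* J. S. Milne, *Arithmetic Duality Theorems*, 2006, I Cor. 2.3. [MilneADT2006]
-/

noncomputable section

open CategoryTheory Function
open Field IsNonarchimedeanLocalField ValuativeRel IntermediateField

universe u

namespace Literature.NumberTheory.GaloisRepresentations

open _root_.TopRep _root_.ContRepresentation _root_.ContinuousCohomology DiscreteGaloisModule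
open LocalWeilDatum

namespace ContinuousRep

section TwoZeroSMul

variable {G : Type u} [Group G] [TopologicalSpace G] [IsTopologicalGroup G] [LocallyCompactSpace G]
variable {Ω : Type u} [AddCommGroup Ω] [TopologicalSpace Ω] [DiscreteTopology Ω] {n : ℕ}
variable {M : Type u} [AddCommGroup M] [TopologicalSpace M] [DiscreteTopology M] [Finite M]

/-- `twoZero` is `ℤ`-linear in `f`. [folklore] -/
theorem twoZero_zsmul (ρ : ContinuousRep G ℤ M) (ω : ContinuousRep G ℤ Ω)
    (ι : continuousCohomology 2 ω.toTopRep →+ ZMod n) (c : ℤ) (f : HomCarrier M Ω) (hf : ∀ g : G, ρ.homRep ω g f = f)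
    (hcf : ∀ g : G, ρ.homRep ω g (c • f) = c • f) (z : continuousCohomology 2 ρ.toTopRep) :
    ρ.twoZero ω ι (c • f) hcf z = c • ρ.twoZero ω ι f hf z := by
  obtain ⟨x, rfl⟩ := twoCocycleClass_surjective _ z
  have e : contTwoCocycles.pullback (ContinuousMonoidHom.id G) (resIdHom ((ρ.evalPairing ω).flip.leftHom (c • f) hcf)) x =
      c • contTwoCocycles.pullback (ContinuousMonoidHom.id G) (resIdHom ((ρ.evalPairing ω).flip.leftHom f hf)) x :=
    Subtype.ext (ContinuousMap.ext fun _ => rfl)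
  rw [twoZero_apply, twoZero_apply, cohomologyMap_twoCocycleClass, cohomologyMap_twoCocycleClass, e,
    ← twoCocycleClassₗ_apply, map_zsmul, map_zsmul, twoCocycleClassₗ_apply]

end TwoZeroSMul

end ContinuousRep

/-! ### Finiteness of `H¹` over closed subgroups of finite index, via Shapiro -/

section Shapiro

variable (F : Type u) [Field F] [ValuativeRel F] [TopologicalSpace F] [IsNonarchimedeanLocalField F] [CharZero F]
variable {X : Type u} [AddCommGroup X] [TopologicalSpace X] [DiscreteTopology X] [Finite X]
variable (S : Subgroup (absoluteGaloisGroup F)) [hS : IsClosed (S : Set (absoluteGaloisGroup F))]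
  [Finite (absoluteGaloisGroup F ⧸ S)]

attribute [local instance] compactSpace_of_isClosed_subgroup discreteTopology_coind

omit [ValuativeRel F] [TopologicalSpace F] [IsNonarchimedeanLocalField F] [CharZero F] hS in
/-- **The induced module `M_Γ^S(X)` of a finite module along a subgroup of finite index is finite**:
`a*` is determined by its values at the inverses of a set of coset representatives
(`a*(s x) = s a*(x)`). [cite: SerreGaloisCohomology1997, I §2.5] -/
theorem finite_coindModule (ρ : ContinuousRep (absoluteGaloisGroup F) ℤ X) :
    Finite (coindModule (ρ.restrict (subgroupIncl S))) := by
  classical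
  refine Finite.of_injective (fun (f : coindModule (ρ.restrict (subgroupIncl S))) (c : absoluteGaloisGroup F ⧸ S) =>
    (f : C(absoluteGaloisGroup F, X)) c.out⁻¹) fun f f' hff' => Subtype.ext (ContinuousMap.ext fun x => ?_)
  -- `x = s · c̃⁻¹` with `c = x⁻¹ S`, `c̃ = x⁻¹ s`
  have hc : ((QuotientGroup.mk x⁻¹ : absoluteGaloisGroup F ⧸ S).out)⁻¹ * x⁻¹ ∈ S := by
    rw [← QuotientGroup.eq, QuotientGroup.out_eq']
  set s : absoluteGaloisGroup F := (((QuotientGroup.mk x⁻¹ : absoluteGaloisGroup F ⧸ S).out)⁻¹ * x⁻¹)⁻¹ with hs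
  have hsS : s ∈ S := S.inv_mem hc
  have hx : x = s * ((QuotientGroup.mk x⁻¹ : absoluteGaloisGroup F ⧸ S).out)⁻¹ := by
    rw [hs, mul_inv_rev, inv_inv, inv_inv, mul_inv_cancel_right]
  have e := congrFun hff' (QuotientGroup.mk x⁻¹)
  change (f : C(absoluteGaloisGroup F, X)) _ = (f' : C(absoluteGaloisGroup F, X)) _ at e
  have key : ∀ g : coindModule (ρ.restrict (subgroupIncl S)),
      (g : C(_, X)) x = (ρ.restrict (subgroupIncl S)) ⟨s, hsS⟩
        ((g : C(_, X)) ((QuotientGroup.mk x⁻¹ : absoluteGaloisGroup F ⧸ S).out)⁻¹) := fun g => by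
    have h := (mem_coind_iff (ρ.restrict (subgroupIncl S)) (g : C(_, X))).1 g.2 ⟨s, hsS⟩
      ((QuotientGroup.mk x⁻¹ : absoluteGaloisGroup F ⧸ S).out)⁻¹
    change (g : C(_, X)) (s * _) = _ at h
    rw [← hx] at h
    exact h
  rw [key f, key f']
  exact congrArg _ e

/-- **`H¹(S, X)` is finite** for a finite discrete `Γ_F`-module `X` (`F` a non-archimedean local
field of characteristic `0`) and a closed subgroup `S` of finite index: the Shapiro map
`H¹(Γ_F, M_Γ^S(X)) → H¹(S, X)` is onto (`sh_extMap`) and its source is finite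
(`finite_galoisCohomology_one_of_isNonarchimedeanLocalField`).
[cite: SerreGaloisCohomology1997, II §5.2 Prop. 14] -/
theorem finite_continuousCohomology_one_restrict [T2Space (absoluteGaloisGroup F)]
    [TotallyDisconnectedSpace (absoluteGaloisGroup F)] (ρ : ContinuousRep (absoluteGaloisGroup F) ℤ X) :
    Finite (continuousCohomology 1 (ρ.restrict (subgroupIncl S)).toTopRep) := by
  haveI := absoluteGaloisGroup_compactSpace F
  haveI := finite_coindModule F S ρ
  haveI : Finite (continuousCohomology 1 (coindRep (ρ.restrict (subgroupIncl S))).toTopRep) :=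
    finite_galoisCohomology_one_of_isNonarchimedeanLocalField (coindRep (ρ.restrict (subgroupIncl S)))
  exact Finite.of_surjective (shMap S ρ 1) fun z => ⟨extMap S ρ 1 z, sh_extMap S ρ 1 z⟩

end Shapiro

/-! ### Lines over `Gal(F̄/E)` when `μ_p` is fixed by `Gal(F̄/E)` -/

section Lines

variable (F : Type u) [Field F] [ValuativeRel F] [TopologicalSpace F] [IsNonarchimedeanLocalField F] [CharZero F]
variable (E : IntermediateField F (AlgebraicClosure F)) [FiniteDimensional F E]
variable {p n : ℕ} [hp : Fact p.Prime] [NeZero n] (hpn : p ∣ n)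
variable (hμ : ∀ (g : galFixing F E) (v : MuCarrier F p), mu F p (g : absoluteGaloisGroup F) v = v)
variable {W : Type u} [AddCommGroup W] [TopologicalSpace W] [DiscreteTopology W] [Finite W]
variable (τ : ContinuousRep (galFixing F E) ℤ W) (hτ : ∀ (g : galFixing F E) (w : W), τ g w = w)
  (hW : Nat.card W = p)

attribute [local instance] compactSpace_of_isClosed_subgroup isClosed_galFixing' finite_quot_galFixing
  Fintype.ofFinite finite_muCarrier

/-- A group isomorphism `W ≃ μ_p` for a group of order `p` (through `ℤ/p`). [folklore] -/
def lineEquivMu {w₀ : W} (hw₀ : w₀ ≠ 0) : W ≃L[ℤ] MuCarrier F p :=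
  let e : W ≃+ MuCarrier F p := (ContinuousRep.lineCoord hW hw₀).trans (muEquivZMod F p).symm
  { e.toIntLinearEquiv with
    continuous_toFun := continuous_of_discreteTopology
    continuous_invFun := continuous_of_discreteTopology }

/-- **A line with trivial action is isomorphic to `μ_p` over `Gal(F̄/E)`** when `μ_p` is fixed by
`Gal(F̄/E)`. [folklore] -/
def lineIsoMu {w₀ : W} (hw₀ : w₀ ≠ 0) :
    τ.toTopRep ≅ ((mu F p).restrict (subgroupIncl (galFixing F E))).toTopRep :=
  topRepIsoOfEquiv (X := τ.toTopRep) (Y := ((mu F p).restrict (subgroupIncl (galFixing F E))).toTopRep)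
    (lineEquivMu F hW hw₀) fun g w => by
      change lineEquivMu F hW hw₀ (τ g w) = mu F p (g : absoluteGaloisGroup F) (lineEquivMu F hW hw₀ w)
      rw [hτ, hμ]

include hτ hW hμ in
/-- `H¹(E, W)` is finite. [cite: SerreGaloisCohomology1997, II §5.2 Prop. 14] -/
theorem finite_one_line : Finite (continuousCohomology 1 τ.toTopRep) := by
  obtain ⟨w₀, hw₀⟩ := ContinuousRep.exists_ne_zero_of_card hW
  haveI := finite_continuousCohomology_one_restrict F (galFixing F E) (mu F p)
  exact Finite.of_equiv _ (continuousCohomologyEquivOfIso (lineIsoMu F E hμ τ hτ hW hw₀) 1).symm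

include hτ hW hpn in
omit [NeZero n] in
/-- `H¹(E, W^D)` is finite (`W^D ≅ μ_n[p] ≅ μ_p`). [cite: SerreGaloisCohomology1997, II §5.2 Prop. 14] -/
theorem finite_one_lineDual :
    Finite (continuousCohomology 1 (τ.homRep ((mu F n).restrict (subgroupIncl (galFixing F E)))).toTopRep) := by
  obtain ⟨w₀, hw₀⟩ := ContinuousRep.exists_ne_zero_of_card hW
  haveI := finite_continuousCohomology_one_restrict F (galFixing F E) (mu F p)
  let e := ContinuousRep.lineHomIso τ ((mu F n).restrict (subgroupIncl (galFixing F E))) hτ hW hw₀ ≪≫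
    muTorsionIso F p hpn (galFixing F E)
  exact Finite.of_equiv _ (continuousCohomologyEquivOfIso e 1).symm

include hτ hW hμ in
/-- `H²(E, W)` is finite, of order `p` (`≅ H²(E, μ_p)`). [cite: SerreGaloisCohomology1997, II §5.2] -/
theorem natCard_two_line :
    Finite (continuousCohomology 2 τ.toTopRep) ∧ Nat.card (continuousCohomology 2 τ.toTopRep) = p := by
  obtain ⟨w₀, hw₀⟩ := ContinuousRep.exists_ne_zero_of_card hW
  haveI := finite_two_mu F E p
  let e := continuousCohomologyEquivOfIso (lineIsoMu F E hμ τ hτ hW hw₀) 2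
  exact ⟨Finite.of_equiv _ e.symm, (Nat.card_congr e).trans (natCard_two_mu_eq F E p)⟩

include hτ hW hpn in
omit [NeZero n] in
/-- `|H²(E, W^D)| = p` (`W^D ≅ μ_p`). [cite: SerreGaloisCohomology1997, II §5.2] -/
theorem natCard_two_lineDual :
    Nat.card (continuousCohomology 2 (τ.homRep ((mu F n).restrict (subgroupIncl (galFixing F E)))).toTopRep) = p := by
  obtain ⟨w₀, hw₀⟩ := ContinuousRep.exists_ne_zero_of_card hW
  let e := ContinuousRep.lineHomIso τ ((mu F n).restrict (subgroupIncl (galFixing F E))) hτ hW hw₀ ≪≫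
    muTorsionIso F p hpn (galFixing F E)
  exact (natCard_continuousCohomology_eq_of_iso e 2).trans (natCard_two_mu_eq F E p)

include hW hpn in
omit [NeZero n] in
/-- **The left kernel of `W × H²(E, W^D) → ℤ/n` is trivial** for a line `W` with trivial action and
an injective `ι` (the right kernel is trivial, `zeroTwo_eq_zero_galFixing`, and `H²(E, W^D) ≠ 0`).
[cite: SerreGaloisCohomology1997, II §5.2 Thm. 2 (`i = 0`)] -/
theorem zeroTwo_left_line
    (ι : continuousCohomology 2 ((mu F n).restrict (subgroupIncl (galFixing F E))).toTopRep →+ ZMod n)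
    (hι : Injective ι) (w : W)
    (hz : ∀ z : continuousCohomology 2 (τ.homRep ((mu F n).restrict (subgroupIncl (galFixing F E)))).toTopRep,
      τ.zeroTwo ((mu F n).restrict (subgroupIncl (galFixing F E))) ι w (hτ · w) z = 0) : w = 0 := by
  by_contra hw0
  -- every `w'` is a multiple of `w`, so the whole pairing vanishes
  have hall : ∀ (w' : W) z, τ.zeroTwo ((mu F n).restrict (subgroupIncl (galFixing F E))) ι w' (hτ · w') z = 0 := by
    intro w' z
    obtain ⟨c, rfl⟩ := AddSubgroup.mem_zmultiples_iff.1 (ContinuousRep.forall_mem_zmultiples_of_card hW hw0 w')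
    have e : τ.zeroTwoHom ((mu F n).restrict (subgroupIncl (galFixing F E))) ι hτ (c • w) =
        c • τ.zeroTwoHom ((mu F n).restrict (subgroupIncl (galFixing F E))) ι hτ w := map_zsmul _ c w
    have e' := congrArg (fun φ : _ →+ ZMod n => φ z) e
    simp only [ContinuousRep.zeroTwoHom_apply, AddMonoidHom.smul_apply] at e'
    rw [e', hz z, smul_zero]
  -- hence `H²(E, W^D) = 0`, contradicting `|H²(E, W^D)| = p`
  have hsub : ∀ z : continuousCohomology 2 (τ.homRep ((mu F n).restrict (subgroupIncl (galFixing F E)))).toTopRep,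
      z = 0 := fun z => zeroTwo_eq_zero_galFixing F E hpn ι hι τ hτ hW z fun w' => hall w' z
  haveI : Subsingleton (continuousCohomology 2 (τ.homRep ((mu F n).restrict (subgroupIncl (galFixing F E)))).toTopRep) :=
    ⟨fun a b => by rw [hsub a, hsub b]⟩
  have h1 := natCard_two_lineDual F E hpn τ hτ hW
  rw [Nat.card_of_subsingleton (0 : continuousCohomology 2 _)] at h1
  exact hp.out.one_lt.ne h1

/-- The embedding `W ≅ μ_p ⊆ μ_n` as an element of `W^D = Hom(W, μ_n)`. [folklore] -/
def lineToMu {w₀ : W} (hw₀ : w₀ ≠ 0) : HomCarrier W (MuCarrier F n) :=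
  HomCarrier.ofAddMonoidHom ((muInclusion F hpn).comp (lineEquivMu F hW hw₀ : W ≃L[ℤ] MuCarrier F p).toLinearEquiv.toAddMonoidHom)

omit [FiniteDimensional F E] [ValuativeRel F] [TopologicalSpace F] [IsNonarchimedeanLocalField F] [NeZero n] in
include hτ hμ in
/-- `lineToMu` is `Gal(F̄/E)`-invariant. [folklore] -/
theorem lineToMu_invariant {w₀ : W} (hw₀ : w₀ ≠ 0) (g : galFixing F E) :
    τ.homRep ((mu F n).restrict (subgroupIncl (galFixing F E))) g (lineToMu F hpn hW hw₀) = lineToMu F hpn hW hw₀ := by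
  rw [ContinuousRep.homRep_apply_eq_self_iff]
  intro w
  change mu F n (g : absoluteGaloisGroup F) (muInclusion F hpn (lineEquivMu F hW hw₀ w)) =
    muInclusion F hpn (lineEquivMu F hW hw₀ (τ g w))
  rw [hτ]
  exact (TopRep.hom_comm_apply (muInclHom F hpn) (g : absoluteGaloisGroup F) (lineEquivMu F hW hw₀ w)).symm.trans
    (congrArg (muInclusion F hpn) (hμ g _))

omit [FiniteDimensional F E] [ValuativeRel F] [TopologicalSpace F] [IsNonarchimedeanLocalField F] [NeZero n] in
/-- `⟨·, lineToMu⟩ = ι ∘ H²(μ_p ⊆ μ_n) ∘ H²(W ≅ μ_p)`. [folklore] -/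
theorem twoZero_lineToMu {w₀ : W} (hw₀ : w₀ ≠ 0)
    (ι : continuousCohomology 2 ((mu F n).restrict (subgroupIncl (galFixing F E))).toTopRep →+ ZMod n)
    (z : continuousCohomology 2 τ.toTopRep) :
    τ.twoZero ((mu F n).restrict (subgroupIncl (galFixing F E))) ι (lineToMu F hpn hW hw₀)
        (lineToMu_invariant F E hpn hμ τ hτ hW hw₀) z =
      ι (cohomologyMap (resModHom (galFixing F E) (muInclHom F hpn)) 2
        (cohomologyMap (lineIsoMu F E hμ τ hτ hW hw₀).hom 2 z)) := by
  obtain ⟨x, rfl⟩ := twoCocycleClass_surjective _ z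
  rw [ContinuousRep.twoZero_apply, cohomologyMap_twoCocycleClass, cohomologyMap_twoCocycleClass,
    cohomologyMap_twoCocycleClass]
  exact congrArg (fun y => ι (twoCocycleClass _ y)) (Subtype.ext (ContinuousMap.ext fun _ => rfl))

omit [TopologicalSpace W] [DiscreteTopology W] [Finite W] in
/-- **`Hom(C, ℤ/n)` is generated by any injection** for a finite cyclic group `C` killed by `n`
(`Hom(C, ℤ/n)` has `|C|` elements and the injection has order `|C|`). [folklore] -/
theorem mem_zmultiples_of_injective {C : Type*} [AddCommGroup C] [Finite C] [IsAddCyclic C]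
    (hC : ∀ c : C, n • c = 0) (ψ : C →+ ZMod n) (hψ : Injective ψ) (μ : C →+ ZMod n) :
    μ ∈ AddSubgroup.zmultiples ψ := by
  classical
  obtain ⟨g₀, hg₀⟩ := IsAddCyclic.exists_zsmul_surjective (G := C)
  haveI : Finite (C →+ ZMod n) := finite_addMonoidHom_zmod C n
  have htop : AddSubgroup.zmultiples g₀ = ⊤ :=
    (AddSubgroup.eq_top_iff' _).2 fun c => AddSubgroup.mem_zmultiples_iff.2 (hg₀ c)
  have hg₀ord : addOrderOf g₀ = Nat.card C := by
    rw [← Nat.card_zmultiples g₀, htop, AddSubgroup.card_top]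
  have hord : addOrderOf ψ = Nat.card C := by
    rw [← hg₀ord, ← addOrderOf_injective ψ hψ g₀]
    apply Nat.dvd_antisymm
    · refine addOrderOf_dvd_of_nsmul_eq_zero (AddMonoidHom.ext fun c => ?_)
      obtain ⟨k, rfl⟩ := hg₀ c
      change addOrderOf (ψ g₀) • ψ (k • g₀) = 0
      rw [map_zsmul, smul_comm, addOrderOf_nsmul_eq_zero, smul_zero]
    · refine addOrderOf_dvd_of_nsmul_eq_zero ?_
      exact congrArg (fun φ : C →+ ZMod n => φ g₀) (addOrderOf_nsmul_eq_zero ψ)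
  have hcard : Nat.card (AddSubgroup.zmultiples ψ) = Nat.card (C →+ ZMod n) := by
    rw [Nat.card_zmultiples, hord, Nat.card_addMonoidHom_zmod hC]
  have htop' : AddSubgroup.zmultiples ψ = ⊤ := AddSubgroup.eq_top_of_card_eq _ hcard
  exact htop' ▸ AddSubgroup.mem_top μ

include hW hpn in
omit [TopologicalSpace W] [DiscreteTopology W] [Finite W] hp [NeZero n] in
/-- `n W = 0` for a line `W` of order `p ∣ n`. [folklore] -/
theorem line_nsmul_eq_zero (w : W) : n • w = 0 := by
  obtain ⟨c, hc⟩ := hpn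
  rw [hc, mul_nsmul]
  simp [ContinuousRep.card_nsmul_eq_zero_of_card hW]

include hpn hμ hτ hW in
/-- **Every additive `H²(E, W) → ℤ/n` is `⟨·, h⟩` for an invariant `h ∈ W^D`** (line with trivial
action, `ι` injective): `⟨·, j⟩ = ι ∘ H²(μ_p ⊆ μ_n) ∘ H²(W ≅ μ_p)` is injective for the embedding
`j : W ≅ μ_p ⊆ μ_n`, `H²(E, W)` is cyclic, and `Hom(C, ℤ/n) = ℤ ⟨·, j⟩`.
[cite: SerreGaloisCohomology1997, II §5.2 Thm. 2 (`i = 2`)] -/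
theorem twoZero_surjective_line
    (ι : continuousCohomology 2 ((mu F n).restrict (subgroupIncl (galFixing F E))).toTopRep →+ ZMod n)
    (hι : Injective ι) (μ' : continuousCohomology 2 τ.toTopRep →+ ZMod n) :
    ∃ (h : HomCarrier W (MuCarrier F n))
      (hh : ∀ g : galFixing F E, τ.homRep ((mu F n).restrict (subgroupIncl (galFixing F E))) g h = h),
      τ.twoZero ((mu F n).restrict (subgroupIncl (galFixing F E))) ι h hh = μ' := by
  obtain ⟨w₀, hw₀⟩ := ContinuousRep.exists_ne_zero_of_card hW
  have hj := lineToMu_invariant F E hpn hμ τ hτ hW hw₀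
  -- `ψ = ⟨·, j⟩` is injective
  have hψ : Injective (τ.twoZero ((mu F n).restrict (subgroupIncl (galFixing F E))) ι (lineToMu F hpn hW hw₀) hj) := by
    intro a b hab
    rw [twoZero_lineToMu F E hpn hμ τ hτ hW hw₀, twoZero_lineToMu F E hpn hμ τ hτ hW hw₀] at hab
    have h2 := cohomologyMap_muInclHom_injective F (galFixing F E) hpn hp.out.pos
      (subsingleton_one_units_galFixing E) (hι hab)
    rw [← cohomologyMap_inv_hom_apply (lineIsoMu F E hμ τ hτ hW hw₀) 2 a,
      ← cohomologyMap_inv_hom_apply (lineIsoMu F E hμ τ hτ hW hw₀) 2 b]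
    exact congrArg _ h2
  -- `H²(E, W)` is finite cyclic, killed by `n`
  haveI : Finite (continuousCohomology 2 τ.toTopRep) := (natCard_two_line F E hμ τ hτ hW).1
  haveI : IsAddCyclic (continuousCohomology 2 τ.toTopRep) := isAddCyclic_of_injective _ hψ
  have hC : ∀ c : continuousCohomology 2 τ.toTopRep, n • c = 0 :=
    nsmul_continuousCohomology_two_eq_zero _ n (line_nsmul_eq_zero hpn hW)
  obtain ⟨c, hc⟩ := AddSubgroup.mem_zmultiples_iff.1 (mem_zmultiples_of_injective hC _ hψ μ')
  have hcj : ∀ g : galFixing F E, τ.homRep ((mu F n).restrict (subgroupIncl (galFixing F E))) g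
      (c • lineToMu F hpn hW hw₀) = c • lineToMu F hpn hW hw₀ := fun g => by rw [map_zsmul, hj g]
  refine ⟨c • lineToMu F hpn hW hw₀, hcj, ?_⟩
  rw [← hc]
  exact AddMonoidHom.ext fun z => ContinuousRep.twoZero_zsmul τ _ ι c _ hj hcj z

include hpn hμ hW hτ in
omit [ValuativeRel F] [TopologicalSpace F] [IsNonarchimedeanLocalField F] [CharZero F] [FiniteDimensional F E] hp
  [NeZero n] in
/-- **`W^D = Hom(W, μ_n)` has trivial action** (its values are `p`-torsion, i.e. in `μ_p`, fixed by
`Gal(F̄/E)`). [folklore] -/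
theorem lineDual_trivial (g : galFixing F E) (h : HomCarrier W (MuCarrier F n)) :
    τ.homRep ((mu F n).restrict (subgroupIncl (galFixing F E))) g h = h := by
  rw [ContinuousRep.homRep_apply_eq_self_iff]
  intro w
  rw [hτ]
  have hpw : p • h w = 0 := by rw [← map_nsmul, ContinuousRep.card_nsmul_eq_zero_of_card hW w, map_zero]
  have hw : h w = muInclusion F hpn (muTorsionEquiv F p hpn
      ⟨h w, (ContinuousRep.mem_torsionBy_nsmul_iff p).2 hpw⟩) := rfl
  rw [hw]
  exact (TopRep.hom_comm_apply (muInclHom F hpn) (g : absoluteGaloisGroup F) _).symm.trans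
    (congrArg (muInclusion F hpn) (hμ g _))

include hpn hμ hτ hW in
/-- **The right kernel of `H¹(E, W) × H¹(E, W^D) → ℤ/n` is trivial** for a line with trivial action
and an injective `ι` (left injectivity for `W` and for the trivial line `W^D`,
`dualityPairing_injective_line`, and counting, `dualityPairing_bijective_of_injective`).
[cite: SerreGaloisCohomology1997, II §5.2 Thm. 2 (`i = 1`)] -/
theorem dualityPairing_right_line
    (ι : continuousCohomology 2 ((mu F n).restrict (subgroupIncl (galFixing F E))).toTopRep →+ ZMod n)
    (hι : Injective ι) (b : continuousCohomology 1 (τ.homRep ((mu F n).restrict (subgroupIncl (galFixing F E)))).toTopRep)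
    (hb : ∀ x : continuousCohomology 1 τ.toTopRep,
      τ.dualityPairing ((mu F n).restrict (subgroupIncl (galFixing F E))) ι x b = 0) : b = 0 := by
  haveI := finite_one_line F E hμ τ hτ hW
  haveI := finite_one_lineDual F E hpn τ hτ hW
  have hWn : ∀ w : W, n • w = 0 := line_nsmul_eq_zero hpn hW
  have h₁ := dualityPairing_injective_line F E hpn ι hι τ hτ hW
  have hWD : Nat.card (HomCarrier W (MuCarrier F n)) = p := (HomCarrier.natCard_eq (muEquivZMod F n) hWn).trans hW
  have h₂ := dualityPairing_injective_line F E hpn ι hι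
    (τ.homRep ((mu F n).restrict (subgroupIncl (galFixing F E)))) (lineDual_trivial F E hpn hμ τ hτ hW) hWD
  have hbij := ContinuousRep.dualityPairing_bijective_of_injective τ _ (muEquivZMod F n) ι hWn h₁ h₂
  have h0 : (τ.dualityPairing ((mu F n).restrict (subgroupIncl (galFixing F E))) ι).flip b = 0 :=
    AddMonoidHom.ext fun x => hb x
  exact (injective_iff_map_eq_zero _).1 hbij.2.1 b h0

end Lines

end Literature.NumberTheory.GaloisRepresentations

end
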